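import Literature.NumberTheory.GaloisCohomology.KatoCohomologyDifferentialForms
import Mathlib.LinearAlgebra.ExteriorPower.Basic
import Mathlib.RingTheory.Kaehler.Basic
import HarnessLib

/-!
# Stub `stub_formsSpan` of crux stmt-ResolutionOfSingularities-17142
# (`WildPurity.PurityTransfer`, line `birth`, lead c1 skeleton rev L4)

The SURJECTIVITY half of Bloch–Kato's Lemma (4.2) for a field `K`: the logarithmic `n`-forms
`dlog b₀ ∧ ⋯ ∧ dlog b_{n-1}` (`dlogForm K b`, `b : Fin n → Kˣ`) span `Ωⁿ_K = ⋀ⁿ_K Ω[K⁄ℤ]` over `K`.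

Proof: `Ω[K⁄ℤ]` is spanned over `K` by the `da` (`KaehlerDifferential.span_range_derivation`), hence
`⋀ⁿ_K Ω[K⁄ℤ]` by the `da₀ ∧ ⋯ ∧ da_{n-1}` (`exteriorPower.ιMulti_span_of_span`); such a product is
`0` if some `aᵢ = 0`, and otherwise equals `(∏ aᵢ) • dlogForm K a` since `da = a • dlog a` for a
unit `a` (multilinearity, `AlternatingMap.map_smul_univ`).
-/

set_option linter.dupNamespace false

noncomputable section

universe u

open Literature.NumberTheory.GaloisCohomology
open KaehlerDifferential (D)

namespace Summit.ResolutionOfSingularities.ResolutionOfSingularities.Theorems.WildPurityPurityTransfer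

/-- For a unit `b` of a commutative ring, `db = b • dlog b`. [folklore] -/
theorem formsSpan_D_eq_smul_unitDlog (K : Type u) [CommRing K] (b : Kˣ) :
    D ℤ K (b : K) = (b : K) • unitDlog K b := by
  unfold unitDlog
  rw [smul_smul, Units.mul_inv, one_smul]

/-- For a tuple of units `b`, `db₀ ∧ ⋯ ∧ db_{n-1} = (∏ bᵢ) • (dlog b₀ ∧ ⋯ ∧ dlog b_{n-1})`.
[folklore] -/
theorem formsSpan_ιMulti_D_eq_prod_smul_dlogForm (K : Type u) [CommRing K] {n : ℕ}
    (b : Fin n → Kˣ) :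
    exteriorPower.ιMulti K n (fun i => D ℤ K (b i : K)) = (∏ i, (b i : K)) • dlogForm K b := by
  unfold dlogForm
  rw [← AlternatingMap.map_smul_univ]
  congr 1
  ext i
  exact formsSpan_D_eq_smul_unitDlog K (b i)

/-- **Bloch–Kato, Lemma (4.2), surjectivity of `δ`, for a field**: the logarithmic forms
`dlog b₀ ∧ ⋯ ∧ dlog b_{n-1}` span `Ωⁿ_K = ⋀ⁿ_K Ω[K⁄ℤ]` over `K`.
[cite: BlochKato1986, Lemma (4.2)] -/
theorem stub_formsSpan (K : Type u) [Field K] (n : ℕ) :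
    Submodule.span K (Set.range (dlogForm K (n := n))) = ⊤ := by
  rw [eq_top_iff, ← exteriorPower.ιMulti_span_of_span K n (Ω[K⁄ℤ])
    (KaehlerDifferential.span_range_derivation (R := ℤ) (S := K)), Submodule.span_le]
  rintro _ ⟨a, ha, rfl⟩
  -- `a : Fin n → Ω[K⁄ℤ]` with every `a i` of the form `D x`
  choose x hx using fun i => ha (Set.mem_range_self (f := a) i)
  by_cases h : ∀ i, x i ≠ 0
  · have ha' : a = fun i => D ℤ K ((Units.mk0 (x i) (h i) : Kˣ) : K) := by
      funext i
      rw [Units.val_mk0, hx i]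
    rw [SetLike.mem_coe, ha', formsSpan_ιMulti_D_eq_prod_smul_dlogForm]
    exact Submodule.smul_mem _ _ (Submodule.subset_span (Set.mem_range_self _))
  · push Not at h
    obtain ⟨i, hi⟩ := h
    have key : exteriorPower.ιMulti K n a = 0 := by
      apply AlternatingMap.map_coord_zero (i := i)
      rw [← hx i, hi, map_zero]
    rw [SetLike.mem_coe, key]
    exact zero_mem _

end Summit.ResolutionOfSingularities.ResolutionOfSingularities.Theorems.WildPurityPurityTransfer

end
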